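import Literature.NumberTheory.LFunctions.FordIncompleteBasics
import HarnessLib

/-!
# Ford's Lemma 4.1: set-up, symmetries and the coincidence case `S₂`

Topic `Literature/NumberTheory/LFunctions`. Everything here is PROVED.

K. Ford, Proc. LMS 85 (2002), Lemma 4.1 splits the solutions of the incomplete system (4.1)
into four classes. Here: the generic "count ≤ ∫ |·||·|" principle on the torus, the split of an
`s = t + m`-tuple into head and rest, permutation symmetries, and the bound for the class `S₂`
(a coincidence `x_a = x_b`): `#S₂-type ≤ J^{1-1/(2s)}` per pair `(a,b)` (Ford: via
`∫ |f^{2s-2} f(2α)|` and Hölder).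

## References

* K. Ford, Proc. London Math. Soc. (3) 85 (2002), 565–633, proof of Lemma 4.1 (cases S₁, S₂).
  [Ford2002]
-/

noncomputable section

open Finset MeasureTheory Complex
open scoped Real ComplexConjugate

namespace Literature.NumberTheory.LFunctions
namespace FordVK

open VMV

/-! ### Counting by integrals -/

/-- **Count ≤ mean of the product of absolute values**: for finite families of frequencies,
`#{(a,b) ∈ S × T : v_a = w_b} ≤ ∫_{[0,1]^n} |∑_{a∈S} e(α·v_a)| |∑_{b∈T} e(α·w_b)| dα`.
[cite: Ford2002, proof of Lemma 4.1 (each "By [orthogonality]" step)] -/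
theorem card_filter_eq_le_integral {n : ℕ} {ι κ : Type*} (S : Finset ι) (T : Finset κ)
    (v : ι → Fin n → ℤ) (w : κ → Fin n → ℤ) :
    ((((S ×ˢ T).filter fun ab => v ab.1 = w ab.2).card : ℕ) : ℝ)
      ≤ ∫ α in box n, ‖tp S v α‖ * ‖tp T w α‖ := by
  have h := integral_tp_mul_conj_tp S T v w
  have h1 : ((((S ×ˢ T).filter fun ab => v ab.1 = w ab.2).card : ℕ) : ℝ)
      = ‖∫ α in box n, tp S v α * conj (tp T w α)‖ := by
    rw [h, Complex.norm_natCast]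
  rw [h1]
  refine (norm_integral_le_integral_norm _).trans (le_of_eq ?_)
  congr 1; funext α
  rw [norm_mul, Complex.norm_conj]

/-! ### Head/rest split of `s = t + m` variables -/

section Split

variable (k h g t m : ℕ) (B : Finset ℤ)

/-- The solutions of the incomplete system with `s = t + m` variables on each side, written with
the head `x : Fin t → ℤ` and the rest `r : Fin m → ℤ` separated. [cite: Ford2002, (4.1)] -/
def SolS : Finset (((Fin t → ℤ) × (Fin m → ℤ)) × ((Fin t → ℤ) × (Fin m → ℤ))) :=
  (((tuples t B) ×ˢ (tuples m B)) ×ˢ ((tuples t B) ×ˢ (tuples m B))).filter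
    fun p => psvR k h g p.1.1 + psvR k h g p.1.2 = psvR k h g p.2.1 + psvR k h g p.2.2

variable {k h g t m B}

/-- Membership in `SolS`. [folklore] -/
theorem mem_SolS {p : ((Fin t → ℤ) × (Fin m → ℤ)) × ((Fin t → ℤ) × (Fin m → ℤ))} :
    p ∈ SolS k h g t m B ↔ (p.1.1 ∈ tuples t B ∧ p.1.2 ∈ tuples m B) ∧
      (p.2.1 ∈ tuples t B ∧ p.2.2 ∈ tuples m B) ∧
      psvR k h g p.1.1 + psvR k h g p.1.2 = psvR k h g p.2.1 + psvR k h g p.2.2 := by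
  unfold SolS; rw [mem_filter, mem_product, mem_product, mem_product, and_assoc]

/-- `s_{[h,g]}(x ++ r) = s_{[h,g]}(x) + s_{[h,g]}(r)`. [folklore] -/
theorem psvR_append (x : Fin t → ℤ) (r : Fin m → ℤ) :
    psvR k h g (Fin.append x r) = psvR k h g x + psvR k h g r := by
  rw [psvR_eq_sum_nuR, psvR_eq_sum_nuR, psvR_eq_sum_nuR, Fin.sum_univ_add]
  simp [Fin.append_left, Fin.append_right]

/-- `x ++ r ∈ ℬ^{t+m} ↔ x ∈ ℬ^t ∧ r ∈ ℬ^m`. [folklore] -/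
theorem append_mem_tuples {x : Fin t → ℤ} {r : Fin m → ℤ} :
    Fin.append x r ∈ tuples (t + m) B ↔ x ∈ tuples t B ∧ r ∈ tuples m B := by
  simp only [mem_tuples]
  constructor
  · intro H
    exact ⟨fun i => by simpa using H (Fin.castAdd m i), fun i => by simpa using H (Fin.natAdd t i)⟩
  · rintro ⟨H1, H2⟩ i
    refine Fin.addCases (fun i => ?_) (fun i => ?_) i
    · simpa using H1 i
    · simpa using H2 i

/-- **The split does not change the count**: `#SolS = J_{t+m,k,[h,g]}(ℬ)`. [folklore] -/
theorem card_SolS : (SolS k h g t m B).card = Jinc k (t + m) B h g := by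
  unfold Jinc solCount
  refine card_equiv ((Fin.appendEquiv t m).prodCongr (Fin.appendEquiv t m)) fun p => ?_
  rw [mem_SolS, mem_filter, mem_product, Equiv.prodCongr_apply, Prod.map_fst, Prod.map_snd]
  have e1 : (Fin.appendEquiv t m) p.1 = Fin.append p.1.1 p.1.2 := rfl
  have e2 : (Fin.appendEquiv t m) p.2 = Fin.append p.2.1 p.2.2 := rfl
  rw [e1, e2, append_mem_tuples, append_mem_tuples, psvR_append, psvR_append, add_zero]
  tauto

end Split

/-! ### Permutation symmetry -/

/-- `s_{[h,g]}(x ∘ σ) = s_{[h,g]}(x)` for a permutation `σ`. [folklore] -/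
theorem psvR_comp_perm {k h g s : ℕ} (x : Fin s → ℤ) (σ : Equiv.Perm (Fin s)) :
    psvR k h g (x ∘ σ) = psvR k h g x := by
  rw [psvR_eq_sum_nuR, psvR_eq_sum_nuR]
  exact Equiv.sum_comp σ (fun i => nuR k h g (x i))

/-- Precomposition with a permutation, as an equivalence of tuples. [folklore] -/
def compPerm {s : ℕ} (σ : Equiv.Perm (Fin s)) : (Fin s → ℤ) ≃ (Fin s → ℤ) where
  toFun x := x ∘ σ
  invFun x := x ∘ σ.symm
  left_inv x := by funext i; simp
  right_inv x := by funext i; simp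

/-- `x ∘ σ ∈ ℬ^s ↔ x ∈ ℬ^s`. [folklore] -/
theorem comp_perm_mem_tuples {s : ℕ} {B : Finset ℤ} {x : Fin s → ℤ} (σ : Equiv.Perm (Fin s)) :
    x ∘ σ ∈ tuples s B ↔ x ∈ tuples s B := by
  simp only [mem_tuples, Function.comp_apply]
  constructor
  · intro H i; simpa using H (σ.symm i)
  · intro H i; exact H _

/-! ### The coincidence case `S₂` -/

/-- A permutation of `Fin s` sending `0 ↦ a` and `1 ↦ b` (`a ≠ b`, `s ≥ 2`). [folklore] -/
theorem exists_perm_zero_one {s' : ℕ} (a b : Fin (s' + 2)) (hab : a ≠ b) :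
    ∃ σ : Equiv.Perm (Fin (s' + 2)), σ 0 = a ∧ σ 1 = b := by
  refine ⟨(Equiv.swap 0 a) * (Equiv.swap 1 ((Equiv.swap 0 a) b)), ?_, ?_⟩
  · rw [Equiv.Perm.mul_apply]
    have h1 : (Equiv.swap 0 a) b ≠ 0 := by
      intro h0
      rw [Equiv.swap_apply_eq_iff, Equiv.swap_apply_left] at h0
      exact hab h0.symm
    rw [Equiv.swap_apply_of_ne_of_ne Fin.zero_ne_one h1.symm, Equiv.swap_apply_left]
  · rw [Equiv.Perm.mul_apply, Equiv.swap_apply_left]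
    exact Equiv.swap_apply_self _ _ _

/-- **Reduction of a coincidence `x_a = x_b` to `x_0 = x_1`.** [folklore] -/
theorem card_coincidence_perm_eq {k h g s' : ℕ} (B : Finset ℤ) (a b : Fin (s' + 2)) (hab : a ≠ b) :
    (((tuples (s' + 2) B) ×ˢ (tuples (s' + 2) B)).filter
        fun p => psvR k h g p.1 = psvR k h g p.2 ∧ p.1 a = p.1 b).card
      = (((tuples (s' + 2) B) ×ˢ (tuples (s' + 2) B)).filter
        fun p => psvR k h g p.1 = psvR k h g p.2 ∧ p.1 0 = p.1 1).card := by
  obtain ⟨σ, h0, h1⟩ := exists_perm_zero_one a b hab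
  symm
  refine card_equiv ((compPerm σ).symm.prodCongr (Equiv.refl _)) fun p => ?_
  simp only [mem_filter, mem_product, Equiv.prodCongr_apply, Prod.map_fst, Prod.map_snd,
    Equiv.refl_apply]
  have e1 : ((compPerm σ).symm p.1) = p.1 ∘ σ.symm := rfl
  rw [e1, comp_perm_mem_tuples, psvR_comp_perm]
  simp only [Function.comp_apply]
  rw [show σ.symm a = 0 by rw [← h0]; simp, show σ.symm b = 1 by rw [← h1]; simp]

/-- **Splitting off the two equal coordinates**: the solutions with `x_0 = x_1` are in bijection
with the solutions of `2ν(c) + s(z) = s(y)`, `c ∈ ℬ`, `z ∈ ℬ^{s-2}`, `y ∈ ℬ^s`.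
[cite: Ford2002, proof of Lemma 4.1 (case S₂: "∫ |f^{2s-2} f(2α)|")] -/
theorem card_coincidence_zero_one_eq {k h g s' : ℕ} (B : Finset ℤ) :
    (((tuples (s' + 2) B) ×ˢ (tuples (s' + 2) B)).filter
        fun p => psvR k h g p.1 = psvR k h g p.2 ∧ p.1 0 = p.1 1).card
      = (((B ×ˢ tuples s' B) ×ˢ (tuples (s' + 2) B)).filter
        fun q => (2 • nuR k h g q.1.1 + psvR k h g q.1.2) = psvR k h g q.2).card := by
  symm
  refine card_nbij' (fun q => (Fin.cons q.1.1 (Fin.cons q.1.1 q.1.2), q.2))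
    (fun p => ((p.1 0, Fin.tail (Fin.tail p.1)), p.2)) ?_ ?_ ?_ ?_
  · intro q hq
    rw [mem_coe, mem_filter, mem_product, mem_product] at hq
    obtain ⟨⟨⟨hc, hz⟩, hy⟩, heq⟩ := hq
    rw [mem_coe, mem_filter, mem_product]
    dsimp only
    refine ⟨⟨?_, hy⟩, ?_, by simp⟩
    · rw [mem_tuples]
      intro i
      refine Fin.cases (by simpa using hc) (fun i => ?_) i
      refine Fin.cases (by simpa using hc) (fun i => ?_) i
      rw [Fin.cons_succ, Fin.cons_succ]; exact (mem_tuples.1 hz) i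
    · rw [← heq, psvR_eq_sum_nuR, psvR_eq_sum_nuR, Fin.sum_univ_succ, Fin.sum_univ_succ]
      simp only [Fin.cons_zero, Fin.cons_succ, two_smul]
      abel
  · intro p hp
    rw [mem_coe, mem_filter, mem_product] at hp
    obtain ⟨⟨hx, hy⟩, heq, h01⟩ := hp
    rw [mem_coe, mem_filter, mem_product, mem_product]
    dsimp only
    refine ⟨⟨⟨(mem_tuples.1 hx) 0, ?_⟩, hy⟩, ?_⟩
    · rw [mem_tuples]; intro i; exact (mem_tuples.1 hx) _
    · rw [← heq, psvR_eq_sum_nuR, psvR_eq_sum_nuR (X := p.1), Fin.sum_univ_succ, Fin.sum_univ_succ]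
      simp only [Fin.tail, two_smul, h01, Fin.succ_zero_eq_one]
      abel
  · intro q _
    dsimp only
    simp only [Fin.cons_zero, Fin.tail_cons]
  · intro p hp
    rw [mem_coe, mem_filter] at hp
    obtain ⟨-, -, h01⟩ := hp
    dsimp only
    ext i
    · refine Fin.cases (by simp) (fun i => ?_) i
      refine Fin.cases (by simp [h01]) (fun i => ?_) i
      simp [Fin.tail]
    · rfl

/-- **The coincidence bound** (Ford's case `S₂`, one pair of indices): the number of solutions with
`x_0 = x_1` is at most `J^{1 - 1/(2s)}`, `J = J_{s,k,[h,g]}(ℬ)`, `s = s' + 2`.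
[cite: Ford2002, proof of Lemma 4.1 (case S₂)] -/
theorem card_coincidence_zero_one_le {k h g s' : ℕ} (B : Finset ℤ) :
    ((((tuples (s' + 2) B) ×ˢ (tuples (s' + 2) B)).filter
        fun p => psvR k h g p.1 = psvR k h g p.2 ∧ p.1 0 = p.1 1).card : ℝ)
      ≤ (Jinc k (s' + 2) B h g : ℝ) ^ (1 - 1 / (2 * ((s' : ℝ) + 2))) := by
  rw [card_coincidence_zero_one_eq]
  have h1 := card_filter_eq_le_integral (n := k) (B ×ˢ tuples s' B) (tuples (s' + 2) B)
    (fun cz => 2 • nuR k h g cz.1 + psvR k h g cz.2) (psvR k h g)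
  refine h1.trans ?_
  -- the integrand is `‖f₂‖ ‖f‖^{2s'+2}`
  set f : (Fin k → ℝ) → ℂ := tp B (nuR k h g) with hf
  set f₂ : (Fin k → ℝ) → ℂ := tp B (fun c => 2 • nuR k h g c) with hf₂
  have hint : ∀ α, ‖tp (B ×ˢ tuples s' B) (fun cz => 2 • nuR k h g cz.1 + psvR k h g cz.2) α‖
      * ‖tp (tuples (s' + 2) B) (psvR k h g) α‖ = ‖f₂ α‖ * ‖f α‖ ^ (2 * s' + 2) := by
    intro α
    have e := tp_mul B (tuples s' B) (fun c => 2 • nuR k h g c) (psvR k h g) α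
    rw [show tp (B ×ˢ tuples s' B) (fun cz => 2 • nuR k h g cz.1 + psvR k h g cz.2) α
        = f₂ α * tp (tuples s' B) (psvR k h g) α from e.symm,
      tp_tuples_psvR, tp_tuples_psvR, norm_mul, norm_pow, norm_pow]
    ring
  simp_rw [hint]
  -- Hölder with exponents `S = 2s` and `S/(S-1)`
  set S : ℝ := 2 * ((s' : ℝ) + 2) with hS
  have hS4 : 4 ≤ S := by rw [hS]; have := (Nat.cast_nonneg s' : (0 : ℝ) ≤ s'); linarith
  have hS0 : 0 < S := by linarith
  have hS1 : 0 < S - 1 := by linarith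
  have hpq : S.HolderConjugate (S / (S - 1)) := by
    rw [Real.holderConjugate_iff]
    refine ⟨by linarith, ?_⟩
    field_simp; ring
  have hFc : Continuous fun α => ‖f₂ α‖ := (continuous_tp _ _).norm
  have hGc : Continuous fun α => ‖f α‖ ^ (2 * s' + 2) := ((continuous_tp _ _).norm).pow _
  have hH := holder_box (F := fun α => ‖f₂ α‖) (G := fun α => ‖f α‖ ^ (2 * s' + 2)) hFc hGc
    (fun α => norm_nonneg _) (fun α => by positivity) hpq
  refine hH.trans ?_
  -- evaluate / bound the two factors
  set J : ℝ := (Jinc k (s' + 2) B h g : ℝ) with hJ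
  have hJ0 : 0 ≤ J := by rw [hJ]; exact Nat.cast_nonneg _
  have hA : ∫ α in box k, ‖f₂ α‖ ^ S = J := by
    have e : ∀ α, ‖f₂ α‖ ^ S = ‖f₂ α‖ ^ (2 * (s' + 2)) := fun α => by
      rw [hS, show 2 * ((s' : ℝ) + 2) = ((2 * (s' + 2) : ℕ) : ℝ) by push_cast; ring, Real.rpow_natCast]
    simp_rw [e]
    rw [hJ, hf₂, integral_norm_tp_two_nuR_pow]
  have hB' : ∫ α in box k, (‖f α‖ ^ (2 * s' + 2)) ^ (S / (S - 1))
      ≤ J ^ ((2 * (s' : ℝ) + 2) * (S / (S - 1)) / S) := by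
    have e : ∀ α, (‖f α‖ ^ (2 * s' + 2)) ^ (S / (S - 1)) = ‖f α‖ ^ ((2 * (s' : ℝ) + 2) * (S / (S - 1))) := by
      intro α
      rw [← Real.rpow_natCast, ← Real.rpow_mul (norm_nonneg _)]
      push_cast; ring_nf
    simp_rw [e]
    have ha : 0 < (2 * (s' : ℝ) + 2) * (S / (S - 1)) := by
      have : 0 < 2 * (s' : ℝ) + 2 := by positivity
      positivity
    have hab : (2 * (s' : ℝ) + 2) * (S / (S - 1)) < S := by
      rw [← lt_div_iff₀ (div_pos hS0 hS1), div_div_eq_mul_div]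
      rw [lt_div_iff₀ hS0, hS]
      nlinarith
    have hmono := integral_rpow_le_rpow_integral (F := fun α => ‖f α‖) (continuous_tp _ _).norm
      (fun α => norm_nonneg _) ha hab
    have hJ' : ∫ α in box k, ‖f α‖ ^ S = J := by
      have e2 : ∀ α, ‖f α‖ ^ S = ‖f α‖ ^ (2 * (s' + 2)) := fun α => by
        rw [hS, show 2 * ((s' : ℝ) + 2) = ((2 * (s' + 2) : ℕ) : ℝ) by push_cast; ring, Real.rpow_natCast]
      simp_rw [e2]; rw [hJ, hf, integral_norm_tp_nuR_pow]
    rw [hJ'] at hmono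
    exact hmono
  rw [hA]
  have hq0 : 0 < 1 / (S / (S - 1)) := by positivity
  calc J ^ (1 / S) * (∫ α in box k, (‖f α‖ ^ (2 * s' + 2)) ^ (S / (S - 1))) ^ (1 / (S / (S - 1)))
      ≤ J ^ (1 / S) * (J ^ ((2 * (s' : ℝ) + 2) * (S / (S - 1)) / S)) ^ (1 / (S / (S - 1))) := by
        refine mul_le_mul_of_nonneg_left ?_ (Real.rpow_nonneg hJ0 _)
        exact Real.rpow_le_rpow (integral_nonneg fun α => by positivity) hB' hq0.le
    _ = J ^ (1 - 1 / S) := by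
        rw [← Real.rpow_mul hJ0, ← Real.rpow_add_of_nonneg hJ0 (by positivity) (by positivity)]
        congr 1
        field_simp
        rw [hS]; ring

/-- **Ford's case `S₂`, per pair**: for `a ≠ b` in `Fin s` (`s ≥ 2`), the solutions of the incomplete
system with `x_a = x_b` number at most `J_{s,k,[h,g]}(ℬ)^{1-1/(2s)}`.
[cite: Ford2002, proof of Lemma 4.1 (case S₂)] -/
theorem card_coincidence_le {k h g s : ℕ} (B : Finset ℤ) (a b : Fin s) (hab : a ≠ b) :
    ((((tuples s B) ×ˢ (tuples s B)).filter
        fun p => psvR k h g p.1 = psvR k h g p.2 ∧ p.1 a = p.1 b).card : ℝ)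
      ≤ (Jinc k s B h g : ℝ) ^ (1 - 1 / (2 * (s : ℝ))) := by
  obtain ⟨s', rfl⟩ : ∃ s', s = s' + 2 := by
    have : 2 ≤ s := by
      by_contra hs
      push Not at hs
      have : Subsingleton (Fin s) := by
        rcases Nat.lt_succ_iff.1 hs |>.eq_or_lt with h1 | h0
        · subst h1; infer_instance
        · have : s = 0 := by omega
          subst this; infer_instance
      exact hab (Subsingleton.elim a b)
    exact ⟨s - 2, by omega⟩
  rw [card_coincidence_perm_eq B a b hab]
  have := card_coincidence_zero_one_le (k := k) (h := h) (g := g) (s' := s') B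
  convert this using 2
  push_cast; ring


end FordVK
end Literature.NumberTheory.LFunctions
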